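import Summits.Langlands.Langlands.Theorems.QuadraticWindowHostInducedRepPaneLaw
import Literature.NumberTheory.Automorphic.AsaiSignCont

/-!
# The pane law in continuation form — stub `stub_paneLaw_cont` of line `one-transparent-pane`
(crux `Summit.Langlands.Langlands.Theses.QuadraticWindow.HostInducedRep`, item stmt-Langlands-10902, wave 4)

LOG (wave-4 worker B, 2026-08-16).  `stub_paneLaw_cont : HEX_CONT → PIN_CONT → TRANSFER_CONT → PANE_CONT`,
the `_cont` variant of the landed `stub_paneLaw_cond` (`…PaneLaw.lean`): the same pure-logic proof with the
raw Asai-sign API (`HasAsaiSign` / `HasAsaiPole`, `hasAsaiSign_iff_of_even/odd`) swapped for the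
continuation-form API of `AsaiSignCont.lean` (`HasAsaiSignCont` / `HasAsaiPoleCont`, `hasAsaiSignCont_iff`
and the unit arithmetic `(-1)^(N+1) = ∓1`), and the transfer used in the direction `P → Q` only.

Setting.  A tower of number fields `F₀ ⊂ K ⊂ L`, `F' ⊂ L`, with `K/F₀` quadratic (involution `cK`),
`L/K` quadratic, `L/F'` quadratic (involution `s`) and `s|_K = cK`; `P` a cuspidal automorphic
representation of `GL_n(𝔸_L)` (`0 < n`), conjugate self-dual almost everywhere w.r.t. `s`; `Q` a cuspidal
automorphic representation of `GL_{2n}(𝔸_K)`, a weak automorphic induction of `P`, conjugate self-dual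
w.r.t. `cK`.

Statement.  GIVEN (i) the existence of a continuation-form Asai sign for conjugate self-dual cuspidal
representations (`hex`, Mok's dichotomy in continuation form), (ii) the archimedean sign pin in
continuation form (`hpin`), (iii) the pole transfer `P.HasAsaiPoleCont s ε → Q.HasAsaiPoleCont cK ε`
through the tower (`htransfer`): if at an `s`-fixed complex place `σ` of `L` the archimedean exponents
`χ σ` of `P` are multiplicity free, `n` in number, and all in `½ + ℤ`, then `Q` has the STANDARD Asai
sign in continuation form, `Q.HasAsaiSignCont cK 1`.

Proof.
1. `hex` gives a sign `κ` with `P.HasAsaiSignCont s κ`.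
2. The pin with `r = ½`: every `a ∈ χ σ` is `m + (n-1)/2 + (1-κ)/4` with `m ∈ ℤ`; since
   `card (χ σ) = n > 0` there is such an `a`, also equal to `m' + ½`; `units_eq_of_half_eq_pin`
   (landed, `…PaneLaw.lean`) gives `κ = 1` if `n` is even and `κ = -1` if `n` is odd.
3. In either parity `P.HasAsaiSignCont s κ = P.HasAsaiPoleCont s ((-1)^(n+1) κ)` is
   `P.HasAsaiPoleCont s (-1)` (`(-1)^(n+1) = -1` for even `n`, `= 1` for odd `n`).
4. The transfer gives `Q.HasAsaiPoleCont cK (-1)`, which for the even rank `2n` is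
   `Q.HasAsaiSignCont cK 1 = Q.HasAsaiPoleCont cK ((-1)^(2n+1) · 1)`.

References: C. P. Mok, *Endoscopic classification of representations of quasi-split unitary groups*,
Mem. AMS 235 (2015), §2.5 and Thm. 2.5.4 (a) [Mok2014]; N. Grbac, F. Shahidi, *Endoscopic transfer for
unitary groups and holomorphy of Asai L-functions*, Pacific J. Math. 276 (2015), Thm. 4.3 [GrbacShahidi2015].
-/

set_option linter.dupNamespace false -- project-wide option (lakefile weak.linter.dupNamespace); `Summit.Langlands.Langlands` is the mandated namespace

open scoped BigOperators Polynomial Classical NumberField Topology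
open Filter Polynomial IsDedekindDomain NumberField
open Literature.NumberTheory.Automorphic Literature.NumberTheory.GaloisRepresentations

namespace Summit.Langlands.Langlands.Theorems.HostInducedRep.OneTransparentPane

/-! ### Unit arithmetic of the continuation-form sign -/

/-- For even `N`, `HasAsaiSignCont c 1` is the continued pole of `As⁻`: `(-1)^(N+1) · 1 = -1`. [folklore] -/
theorem hasAsaiSignCont_one_iff_of_even {F E : Type} [Field F] [NumberField F] [Field E] [NumberField E]
    [Algebra F E] {N : ℕ} {hcpt : isCompact_glFiniteIntegralLevel N E} (hN : Even N)
    (π : AutomorphicRepData (AutomorphyDatum.gl N E hcpt)) (c : E ≃ₐ[F] E) :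
    π.HasAsaiSignCont c 1 ↔ π.HasAsaiPoleCont c (-1) := by
  have h1 : ((-1 : ℤˣ) ^ (N + 1)) = -1 := (hN.add_one).neg_one_pow
  rw [AutomorphicRepData.hasAsaiSignCont_iff, h1, mul_one]

/-- For odd `N`, `HasAsaiSignCont c (-1)` is the continued pole of `As⁻`: `(-1)^(N+1) · (-1) = -1`.
[folklore] -/
theorem hasAsaiSignCont_neg_one_iff_of_odd {F E : Type} [Field F] [NumberField F] [Field E]
    [NumberField E] [Algebra F E] {N : ℕ} {hcpt : isCompact_glFiniteIntegralLevel N E} (hN : Odd N)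
    (π : AutomorphicRepData (AutomorphyDatum.gl N E hcpt)) (c : E ≃ₐ[F] E) :
    π.HasAsaiSignCont c (-1) ↔ π.HasAsaiPoleCont c (-1) := by
  have h1 : ((-1 : ℤˣ) ^ (N + 1)) = 1 := (hN.add_one).neg_one_pow
  rw [AutomorphicRepData.hasAsaiSignCont_iff, h1, one_mul]

/-! ### The pane law, continuation form -/

/-- **The pane law in continuation form** (stub `stub_paneLaw_cont` of line `one-transparent-pane`,
wave 4).  GIVEN the existence of continuation-form Asai signs of conjugate self-dual cuspidal
representations (`hex`), the archimedean sign pin in continuation form (`hpin`) and the pole transfer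
`P → Q` through the biquadratic tower (`htransfer`): if `P` (cuspidal on `GL_n/L`, `s`-conjugate
self-dual, `Q = AI_{L/K}(P)` cuspidal and `cK`-conjugate self-dual) shows at an `s`-fixed complex place
`σ` of `L` a multiplicity-free set of `n` exponents all in `½ + ℤ`, then `Q` has the STANDARD Asai sign
`HasAsaiSignCont cK 1` (the continued `L^S(s, Q, As⁻)` has the pole at `s = 1`).  Proof: `hex` gives a
sign `κ` of `P`; the pin with `r = ½` at some `a ∈ χ σ` (`card = n > 0`) forces `κ = 1` for even `n` and
`κ = -1` for odd `n` (`units_eq_of_half_eq_pin`), i.e. `P.HasAsaiPoleCont s (-1)` in both parities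
(`hasAsaiSignCont_one_iff_of_even` / `hasAsaiSignCont_neg_one_iff_of_odd`); the transfer gives
`Q.HasAsaiPoleCont cK (-1)`, which is `Q.HasAsaiSignCont cK 1` for the even rank `2n`.
[cite: Mok2014, Thm. 2.5.4 (a)] -/
theorem stub_paneLaw_cont : (∀ (F E : Type) [Field F] [NumberField F] [Field E] [NumberField E] [Algebra F E] (c : E ≃ₐ[F] E), Module.finrank F E = 2 → c ≠ 1 → ∀ (N : ℕ) (hcpt : isCompact_glFiniteIntegralLevel N E) (P : CuspidalAutomorphicRepData N E hcpt), 0 < N → P.1.IsConjSelfDualAE c → ∃ κ : ℤˣ, P.1.HasAsaiSignCont c κ) → (∀ (F E : Type) [Field F] [NumberField F] [Field E] [NumberField E] [Algebra F E] (c : E ≃ₐ[F] E), Module.finrank F E = 2 → c ≠ 1 → ∀ (N : ℕ) (hcpt : isCompact_glFiniteIntegralLevel N E) (P : CuspidalAutomorphicRepData N E hcpt) (κ : ℤˣ) (χ : (E →+* ℂ) → Multiset ℂ) (σ : E →+* ℂ) (r : ℝ), 0 < N → P.1.IsConjSelfDualAE c → P.1.HasAsaiSignCont c κ → P.1.HasArchParameter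 χ → NumberField.ComplexEmbedding.IsConj σ c → (χ σ).Nodup → (∀ a ∈ χ σ, ∃ m : ℤ, a = (m : ℂ) + (r : ℂ)) → ∀ a ∈ χ σ, ∃ m : ℤ, a = (m : ℂ) + ((N : ℂ) - 1) / 2 + (1 - ((κ : ℤ) : ℂ)) / 4) → (∀ (F₀ K F' L : Type) [Field F₀] [NumberField F₀] [Field K] [NumberField K] [Field F'] [NumberField F'] [Field L] [NumberField L] [Algebra F₀ K] [Algebra K L] [Algebra F' L] (cK : K ≃ₐ[F₀] K) (s : L ≃ₐ[F'] L), Module.finrank F₀ K = 2 → Module.finrank K L = 2 → Module.finrank F' L = 2 → cK ≠ 1 → s ≠ 1 → (∀ x : K, s (algebraMap K L x) = algebraMap K L (cK x)) → ∀ (n : ℕ) (hL : isCompact_glFiniteIntegralLevel n L) (hK : isCompact_glFiniteIntegralLevel (2 * n) K) (P : CuspidalAutomorphicRepData n L hL) (Q : CuspidalAutomorphicRepData (2 * n) K hK), 0 < n → IsAutomorphicInductionAlong P.1 Q.1 → P.1.IsConjSelfDualAE s → Q.1.IsConjSelfDualAE cK → ∀ ε : ℤˣ, P.1.HasAsaiPoleCont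 s ε → Q.1.HasAsaiPoleCont cK ε) → ∀ (F₀ K F' L : Type) [Field F₀] [NumberField F₀] [Field K] [NumberField K] [Field F'] [NumberField F'] [Field L] [NumberField L] [Algebra F₀ K] [Algebra K L] [Algebra F' L] (cK : K ≃ₐ[F₀] K) (s : L ≃ₐ[F'] L), Module.finrank F₀ K = 2 → Module.finrank K L = 2 → Module.finrank F' L = 2 → cK ≠ 1 → s ≠ 1 → (∀ x : K, s (algebraMap K L x) = algebraMap K L (cK x)) → ∀ (n : ℕ) (hL : isCompact_glFiniteIntegralLevel n L) (hK : isCompact_glFiniteIntegralLevel (2 * n) K) (P : CuspidalAutomorphicRepData n L hL) (Q : CuspidalAutomorphicRepData (2 * n) K hK) (χ : (L →+* ℂ) → Multiset ℂ) (σ : L →+* ℂ), 0 < n → IsAutomorphicInductionAlong P.1 Q.1 → P.1.IsConjSelfDualAE s → Q.1.IsConjSelfDualAE cK → P.1.HasArchParameter χ → NumberField.ComplexEmbedding.IsConj σ s → (χ σ).Nodup → Multiset.card (χ σ) = n → (∀ a ∈ χ σ, ∃ m : ℤ, a = (m : ℂ) + 1 / 2) → Q.1.HasAsaiSignCont cK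 1 := by
  intro hex hpin htransfer F₀ K F' L _ _ _ _ _ _ _ _ _ _ _ cK s h2K h2L h2' hcK hs hcomm n hL hK P Q χ σ
    hn hAI hPcsd hQcsd hχ hσ hnodup hcard hhalf
  -- (1) existence of a continuation-form Asai sign `κ` of `P` (supplied as `hex`).
  obtain ⟨κ, hκ⟩ := hex F' L s h2' hs n hL P hn hPcsd
  -- (2) the pin with `r = ½`.
  have hhalf' : ∀ a ∈ χ σ, ∃ m : ℤ, a = (m : ℂ) + ((1 / 2 : ℝ) : ℂ) := by
    intro a ha
    obtain ⟨m, hm⟩ := hhalf a ha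
    exact ⟨m, by rw [hm]; push_cast; ring⟩
  have hpinned := hpin F' L s h2' hs n hL P κ χ σ (1 / 2 : ℝ) hn hPcsd hκ hχ hσ hnodup hhalf'
  -- an exponent exists since `card (χ σ) = n > 0`
  obtain ⟨a, ha⟩ : ∃ a, a ∈ χ σ := Multiset.card_pos_iff_exists_mem.mp (hcard ▸ hn)
  obtain ⟨m', hm'⟩ := hhalf a ha
  obtain ⟨m, hm⟩ := hpinned a ha
  have hparity := units_eq_of_half_eq_pin (m := m) (m' := m') (n := n) (κ := κ) (hm' ▸ hm)
  -- (3) in both parities, `P.HasAsaiPoleCont s (-1)`.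
  have hP : P.1.HasAsaiPoleCont s (-1) := by
    rcases Nat.even_or_odd n with hev | hodd
    · have h1 : κ = 1 := hparity.1 hev
      subst h1
      exact (hasAsaiSignCont_one_iff_of_even hev P.1 s).mp hκ
    · have h1 : κ = -1 := hparity.2 hodd
      subst h1
      exact (hasAsaiSignCont_neg_one_iff_of_odd hodd P.1 s).mp hκ
  -- (4) transfer to `Q` and read the sign in the even rank `2n`.
  have hQ : Q.1.HasAsaiPoleCont cK (-1) :=
    htransfer F₀ K F' L cK s h2K h2L h2' hcK hs hcomm n hL hK P Q hn hAI hPcsd hQcsd (-1) hP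
  exact (hasAsaiSignCont_one_iff_of_even (even_two_mul n) Q.1 cK).mpr hQ

end Summit.Langlands.Langlands.Theorems.HostInducedRep.OneTransparentPane
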